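import Summits.AtomisticToContinuum.HydrodynamicLimit.Theses.JParityClosure
import Summits.AtomisticToContinuum.HydrodynamicLimit.Theses.ImplosionDichotomy
import Summits.AtomisticToContinuum.HydrodynamicLimit.Theorems.DensityCap.Negative.MollifiedDensity
import Summits.AtomisticToContinuum.HydrodynamicLimit.Theorems.DensityCap.Negative.KernelMass
import Summits.AtomisticToContinuum.HydrodynamicLimit.Theorems.DensityCap.Negative.Equilibrium
import Literature.Analysis.FluidPDE.HardSphereDynamicsProofs
import Literature.Analysis.FluidPDE.HardSphereRegularGeometry
import Literature.Analysis.FluidPDE.HardSphereTorusMeasure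
import Literature.Analysis.FluidPDE.HardSpherePhaseSpaceProofs
import Literature.Analysis.FunctionSpaces.TorusSpaceTime
import Mathlib.Analysis.Calculus.MeanValue
import Summits.AtomisticToContinuum.HydrodynamicLimit.Theorems.JParityClosureDensityCapMeanDisplacement
import Summits.AtomisticToContinuum.HydrodynamicLimit.Theorems.JParityClosureDensityCapEulerDensityModulus

/-!
# drefute gen-3: line `lipschitz-clock-free-past-cap` — the skeleton's composition re-run against the LANDED stubs
(crux `JParityClosure.DensityCap`, stmt-AtomisticToContinuum-13082; skeleton LEAD RESHAPE v1, sha 586f0016…)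

Independent third pass. STUB A and STUB B are now TREE THEOREMS
(`Summit.AtomisticToContinuum.HydrodynamicLimit.Theorems.stub_meanDisplacement`, p76245;
`…Theorems.stub_eulerDensityModulus`, p76778): here they enter as one-line ALIASES with the registered signatures
(so the landed statements are verbatim the skeleton's), STUB D / STUB E are the gen-1 / gen-2 candidate proofs
(copied), and §G is the skeleton's glue + composition copied verbatim. Result, kernel-checked, NO `sorry`:
* `DensityCap_of : ImplosionDichotomy.HydroLimitInBand → JParityClosure.DiluteSelfConsistency → JParityClosure.DensityCap`;
* `densityCap_of_hydrodynamicLimit : HydrodynamicLimit → JParityClosure.DensityCap`;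
* §I (new) MINIMAL SIGNATURES: `gridUpgrade_min` = STUB E with `hdisp` dropped (it is the landed theorem A) and `ht`
  dropped (`capLimit_of_neg`: `t < 0` is trivial) — the reusable "energy tightness + density modulus + fixed-time
  density LLN on `[0,t]` ⇒ cap" lemma; `capEventSubset_min` = STUB D with `hclock`, `hlip` dropped (theorems for every
  flow and `r > 0`);
* root-level FQN pins (after `end`, no `open` in force): the composition concludes
  `Summit.AtomisticToContinuum.HydrodynamicLimit.Theses.JParityClosure.DensityCap` itself.
POSITIVE content — attached as item evidence for the lead (a refuter lands only `¬`-theorems).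
refuter-drefute-stmt-AtomisticToContinuum-13082-g3-0, 2026-08-16 (building on gen-1 `DrefuteStubChecks`/`DrefuteNetProbe`
and gen-2 `DrefuteG2LineComplete`).
-/

noncomputable section

namespace DrefuteG3.LandedCompose

open MeasureTheory Filter Set Topology Metric
open scoped ENNReal BigOperators
open Literature.MathematicalPhysics.KineticTheory Literature.Analysis.FluidPDE
open Literature.Analysis.FunctionSpaces (Torus.IsSmoothSpaceTimeOn Torus.stLift Torus.stLift_apply Torus.proj)
open Summit.AtomisticToContinuum.HydrodynamicLimit.Theorems.DensityCapNegative
  (cone mollDensity capEvent CapLimit densityCap_iff mollDensity_le mollDensity_eq cone_nonneg cone_le cone_self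
    integral_cone coneMass coneMass_eq_one constState_isSolution tendstoHydroFieldsAt_homogeneous)
open Summit.AtomisticToContinuum.HydrodynamicLimit.Theorems.PolynomialCompressionPDE (Flows)
open Summit.AtomisticToContinuum.HydrodynamicLimit

/-! ## §A STUB A -/


/-- Mean ≤ quadratic mean (Cauchy–Schwarz), in the form the clock needs. -/
theorem mean_le_sqrt_mean_sq {n : ℕ} (a : Fin n → ℝ) (ha : ∀ i, 0 ≤ a i) :
    (n : ℝ)⁻¹ * ∑ i, a i ≤ Real.sqrt ((n : ℝ)⁻¹ * ∑ i, a i ^ 2) := by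
  rcases Nat.eq_zero_or_pos n with hn | hn
  · subst hn
    simp
  have hn' : (0 : ℝ) < n := by exact_mod_cast hn
  have hsum : 0 ≤ ∑ i, a i := Finset.sum_nonneg fun i _ => ha i
  have hlhs : 0 ≤ (n : ℝ)⁻¹ * ∑ i, a i := mul_nonneg (inv_nonneg.2 hn'.le) hsum
  rw [show (n : ℝ)⁻¹ * ∑ i, a i = Real.sqrt (((n : ℝ)⁻¹ * ∑ i, a i) ^ 2) from
    (Real.sqrt_sq hlhs).symm]
  refine Real.sqrt_le_sqrt ?_
  have hcs : (∑ i, a i) ^ 2 ≤ (Finset.univ : Finset (Fin n)).card * ∑ i, a i ^ 2 :=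
    sq_sum_le_card_mul_sum_sq
  rw [Finset.card_univ, Fintype.card_fin] at hcs
  calc ((n : ℝ)⁻¹ * ∑ i, a i) ^ 2 = (n : ℝ)⁻¹ * ((n : ℝ)⁻¹ * (∑ i, a i) ^ 2) := by ring
    _ ≤ (n : ℝ)⁻¹ * ((n : ℝ)⁻¹ * (n * ∑ i, a i ^ 2)) := by gcongr
    _ = (n : ℝ)⁻¹ * ∑ i, a i ^ 2 := by
        field_simp

/-- Minimal-image displacement of a translated point is at most the length of the translation. -/
theorem euclidDist_add_proj_le (x : T3) (a : V3) :
    Torus.euclidDist (x + Literature.Analysis.FunctionSpaces.Torus.proj a) x ≤ ‖a‖ := by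
  rw [Torus.euclidDist_eq, add_sub_cancel_left]
  exact Torus.norm_reprSym_le_of_proj_eq rfl

/-- Triangle inequality for the minimal-image distance (re-proved here to keep imports light). -/
theorem euclidDist_triangle' (x y w : T3) :
    Torus.euclidDist x w ≤ Torus.euclidDist x y + Torus.euclidDist y w := by
  have hproj : Literature.Analysis.FunctionSpaces.Torus.proj (Torus.reprSym (x - y) + Torus.reprSym (y - w)) =
      x - w := by
    rw [Literature.Analysis.FunctionSpaces.Torus.proj_add, Torus.proj_reprSym, Torus.proj_reprSym]
    abel
  rw [Torus.euclidDist_eq, Torus.euclidDist_eq, Torus.euclidDist_eq]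
  exact (Torus.norm_reprSym_le_of_proj_eq hproj).trans (norm_add_le _ _)

/-- The mean speed of a configuration is at most its quadratic-mean speed `√(2K/n)`. -/
theorem mean_speed_le {n : ℕ} (w : Config n (Fin 3) T3) :
    (n : ℝ)⁻¹ * ∑ i, ‖(w i).2‖ ≤ Real.sqrt (2 * ((n : ℝ)⁻¹ * configEnergy w)) := by
  have h := mean_le_sqrt_mean_sq (fun i => ‖(w i).2‖) fun i => norm_nonneg _
  have hE : 2 * ((n : ℝ)⁻¹ * configEnergy w) = (n : ℝ)⁻¹ * ∑ i, ‖(w i).2‖ ^ 2 := by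
    unfold configEnergy
    ring
  rw [hE]
  exact h

/-- The mean minimal-image displacement of a curve in phase space between times `s` and `τ`. -/
def mdisp {n : ℕ} (γ : ℝ → Config n (Fin 3) T3) (s τ : ℝ) : ℝ :=
  (n : ℝ)⁻¹ * ∑ i, Torus.euclidDist ((γ τ i).1) ((γ s i).1)

theorem mdisp_self {n : ℕ} (γ : ℝ → Config n (Fin 3) T3) (s : ℝ) : mdisp γ s s = 0 := by
  simp [mdisp]

theorem continuous_mdisp {ε : ℝ} {n : ℕ} {γ : ℝ → Config n (Fin 3) T3}
    (h : IsHardSphereTrajectory (Torus.geometry (Fin 3)) ε n γ) (s : ℝ) : Continuous (mdisp γ s) := by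
  unfold mdisp
  refine continuous_const.mul (continuous_finsetSum _ fun i _ => ?_)
  have h1 : Continuous fun τ => (γ τ i).1 := h.pos_continuous i
  have h2 : Continuous fun τ : ℝ => (γ τ i).1 - (γ s i).1 := h1.sub continuous_const
  -- NB: `Torus.continuous_euclidDist.comp (h1.prodMk continuous_const)` times out at `isDefEq`
  -- (`Prod.fst` coincidence `T3 × T3` vs `T3 × V3`); go through `‖reprSym (· − ·)‖` instead.
  simp only [Torus.euclidDist_eq]
  exact Torus.continuous_norm_reprSym.comp h2

/-- One free-flight step of the clock: on a collision-free stretch `[x, y]` issued from `γ x`, the mean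
displacement grows by at most `(y − x)·√(2K/n)`. -/
theorem mdisp_freeFlight_step {n : ℕ} (γ : ℝ → Config n (Fin 3) T3) (s : ℝ) {x y : ℝ} (hxy : x < y)
    (hflight : γ y = freeFlight (Torus.geometry (Fin 3)) (y - x) (γ x)) :
    mdisp γ s y - mdisp γ s x ≤ (y - x) * Real.sqrt (2 * ((n : ℝ)⁻¹ * configEnergy (γ x))) := by
  have hstep : ∀ i, Torus.euclidDist ((γ y i).1) ((γ s i).1) - Torus.euclidDist ((γ x i).1) ((γ s i).1)
      ≤ (y - x) * ‖(γ x i).2‖ := by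
    intro i
    have htri := euclidDist_triangle' ((γ y i).1) ((γ x i).1) ((γ s i).1)
    have hmove : Torus.euclidDist ((γ y i).1) ((γ x i).1) ≤ (y - x) * ‖(γ x i).2‖ := by
      rw [hflight, freeFlight_apply, Torus.geometry_translate]
      refine (euclidDist_add_proj_le _ _).trans ?_
      rw [norm_smul, Real.norm_eq_abs, abs_of_pos (sub_pos.2 hxy)]
    linarith
  have hsum : ∑ i, (Torus.euclidDist ((γ y i).1) ((γ s i).1) - Torus.euclidDist ((γ x i).1) ((γ s i).1))
      ≤ ∑ i, (y - x) * ‖(γ x i).2‖ := Finset.sum_le_sum fun i _ => hstep i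
  have hn0 : 0 ≤ (n : ℝ)⁻¹ := inv_nonneg.2 (Nat.cast_nonneg n)
  calc mdisp γ s y - mdisp γ s x = (n : ℝ)⁻¹ * ∑ i, (Torus.euclidDist ((γ y i).1) ((γ s i).1) -
        Torus.euclidDist ((γ x i).1) ((γ s i).1)) := by
        simp only [mdisp, Finset.sum_sub_distrib, mul_sub]
    _ ≤ (n : ℝ)⁻¹ * ∑ i, (y - x) * ‖(γ x i).2‖ := mul_le_mul_of_nonneg_left hsum hn0
    _ = (y - x) * ((n : ℝ)⁻¹ * ∑ i, ‖(γ x i).2‖) := by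
        rw [← Finset.mul_sum]
        ring
    _ ≤ (y - x) * Real.sqrt (2 * ((n : ℝ)⁻¹ * configEnergy (γ x))) :=
        mul_le_mul_of_nonneg_left (mean_speed_le (γ x)) (sub_pos.2 hxy).le

/-- **The clock at trajectory level, forward in time**: for every hard-sphere trajectory on `𝕋³` and
`s ≤ s'`, `n⁻¹ ∑ᵢ d(xᵢ(s'), xᵢ(s)) ≤ √(2K(γ s)/n)·(s' − s)`. -/
theorem traj_meanDisplacement_le {ε : ℝ} {n : ℕ} {γ : ℝ → Config n (Fin 3) T3}
    (h : IsHardSphereTrajectory (Torus.geometry (Fin 3)) ε n γ) {s s' : ℝ} (hss' : s ≤ s') :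
    mdisp γ s s' ≤ Real.sqrt (2 * ((n : ℝ)⁻¹ * configEnergy (γ s))) * (s' - s) := by
  have hK : ∀ τ, configEnergy (γ τ) = configEnergy (γ s) := fun τ =>
    IsHardSphereTrajectory.configEnergy_eq_holds h τ s
  have key : ∀ ⦃x⦄, x ∈ Icc s s' →
      mdisp γ s x ≤ (fun x => Real.sqrt (2 * ((n : ℝ)⁻¹ * configEnergy (γ s))) * (x - s)) x := by
    refine image_le_of_liminf_slope_right_le_deriv_boundary (f := mdisp γ s)
      (B := fun x => Real.sqrt (2 * ((n : ℝ)⁻¹ * configEnergy (γ s))) * (x - s))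
      (B' := fun _ => Real.sqrt (2 * ((n : ℝ)⁻¹ * configEnergy (γ s))))
      (continuous_mdisp h s).continuousOn ?_ ?_ ?_ ?_
    · rw [mdisp_self, sub_self, mul_zero]
    · exact continuousOn_const.mul (continuousOn_id.sub continuousOn_const)
    · intro x _
      have := ((hasDerivWithinAt_id x (Ici x)).sub_const s).const_mul
        (Real.sqrt (2 * ((n : ℝ)⁻¹ * configEnergy (γ s))))
      simpa using this
    · intro x _ r hr
      obtain ⟨u, hxu, hfree⟩ := h.exists_Ioo_right_free x
      have hev : ∀ᶠ y in 𝓝[>] x, slope (mdisp γ s) x y < r := by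
        filter_upwards [Ioo_mem_nhdsGT hxu] with y hy
        have hxy : x < y := hy.1
        have hflight : γ y = freeFlight (Torus.geometry (Fin 3)) (y - x) (γ x) :=
          h.eq_freeFlight_of_Ioo_free hfree ⟨hxy.le, hy.2⟩
        have hdiff := mdisp_freeFlight_step γ s hxy hflight
        rw [hK x] at hdiff
        rw [slope_def_field, div_lt_iff₀ (sub_pos.2 hxy)]
        calc mdisp γ s y - mdisp γ s x ≤ (y - x) * Real.sqrt (2 * ((n : ℝ)⁻¹ * configEnergy (γ s))) := hdiff
          _ < r * (y - x) := by
              rw [mul_comm]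
              exact mul_lt_mul_of_pos_right hr (sub_pos.2 hxy)
      exact hev.frequently
  exact key ⟨hss', le_rfl⟩

/-- **STUB A — `stub_meanDisplacement`, verbatim signature — here an ALIAS of the LANDED theorem (p76245).** -/
theorem stub_meanDisplacement {ε : ℝ} {n : ℕ} (Ψ : HardSphereFlow (Torus.geometry (Fin 3)) ε n)
    {z : Config n (Fin 3) T3} (hz : z ∈ Ψ.good) (s s' : ℝ) :
    (n : ℝ)⁻¹ * ∑ i, Torus.euclidDist ((Ψ.flow s' z i).1) ((Ψ.flow s z i).1) ≤
      Real.sqrt (2 * ((n : ℝ)⁻¹ * configEnergy z)) * |s' - s| :=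
  Summit.AtomisticToContinuum.HydrodynamicLimit.Theorems.stub_meanDisplacement Ψ hz s s'

/-! ## §B STUB B -/


/-- `‖reprSym x‖ ≤ 1` on `𝕋³` (`≤ √3/2`). -/
theorem norm_reprSym_le_one (x : T3) : ‖Torus.reprSym x‖ ≤ 1 := by
  have h := Torus.norm_reprSym_le_holds x
  rw [Fintype.card_fin] at h
  push_cast at h
  have h3 : Real.sqrt (3 : ℝ) ≤ 2 := by
    rw [show (2 : ℝ) = Real.sqrt (2 ^ 2) from (Real.sqrt_sq (by norm_num)).symm]
    exact Real.sqrt_le_sqrt (by norm_num)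
  linarith

/-- The cone kernel is continuous in the particle slot. -/
theorem continuous_cone_left (r : ℝ) (x : T3) : Continuous fun y : T3 => cone r y x := by
  unfold cone
  simp only [Torus.euclidDist_eq]
  refine continuous_const.mul ((continuous_const.sub ?_).max continuous_const)
  exact (Torus.continuous_norm_reprSym.comp (continuous_id.sub continuous_const)).div_const r

/-- The cone kernel is symmetric. -/
theorem cone_symm (r : ℝ) (x y : T3) : cone r x y = cone r y x := by
  unfold cone
  rw [Torus.euclidDist_comm]

/-- The Haar mass of the cone kernel in the particle slot is `1` (`0 < r ≤ 1/2`). -/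
theorem integral_cone_left {r : ℝ} (hr : 0 < r) (hr2 : r ≤ 1 / 2) (x : T3) : ∫ y, cone r y x = 1 := by
  simp_rw [fun y => cone_symm r y x]
  rw [integral_cone, coneMass_eq_one hr hr2]

/-- A continuous real function on `𝕋³` is integrable for the Haar probability measure. -/
theorem integrable_of_continuous_T3 {f : T3 → ℝ} (hf : Continuous f) : Integrable f volume := by
  obtain ⟨C, hC⟩ := isCompact_univ.exists_bound_of_continuousOn hf.continuousOn
  exact Integrable.of_bound hf.aestronglyMeasurable C (ae_of_all _ fun y => hC y (mem_univ y))

/-- **STUB B — `stub_eulerDensityModulus`, verbatim signature — here an ALIAS of the LANDED theorem (p76778).** -/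
theorem stub_eulerDensityModulus {T : ℝ} {ρ : ℝ → T3 → ℝ}
    (hρ : Torus.IsSmoothSpaceTimeOn (Ico 0 T) ρ) {t : ℝ} (ht : t ∈ Ico 0 T) :
    ∀ η : ℝ, 0 < η → ∃ r₀ : ℝ, 0 < r₀ ∧ r₀ ≤ 1 / 2 ∧
      (∀ r : ℝ, 0 < r → r < r₀ → ∀ s ∈ Icc 0 t, ∀ x : T3, ∫ y, cone r y x * ρ s y ≤ ρ s x + η) ∧
      ∃ τ₀ : ℝ, 0 < τ₀ ∧ ∀ s ∈ Icc 0 t, ∀ s' ∈ Icc 0 t, |s - s'| ≤ τ₀ →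
        ∀ x x' : T3, Torus.euclidDist x x' ≤ r₀ → |ρ s x - ρ s' x'| ≤ η :=
  Summit.AtomisticToContinuum.HydrodynamicLimit.Theorems.stub_eulerDensityModulus hρ ht

/-! ## §E nets, glue, STUB D, STUB E -/


/-! ## §1 Nets (gen-1 `DrefuteNetProbe`, copied) -/

theorem exists_euclidDist_net {δ : ℝ} (hδ : 0 < δ) :
    ∃ Sx : Finset T3, ∀ x : T3, ∃ x' ∈ Sx, Torus.euclidDist x x' ≤ δ := by
  have h3 : (0 : ℝ) < Real.sqrt 3 := Real.sqrt_pos.2 (by norm_num)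
  obtain ⟨S, -, hSfin, hcover⟩ :=
    finite_cover_balls_of_compact (isCompact_univ (X := T3)) (e := δ / Real.sqrt 3) (by positivity)
  refine ⟨hSfin.toFinset, fun x => ?_⟩
  obtain ⟨x', hx', hxx'⟩ := Set.mem_iUnion₂.1 (hcover (Set.mem_univ x))
  refine ⟨x', hSfin.mem_toFinset.2 hx', ?_⟩
  have hle := Torus.euclidDist_le_holds x x'
  rw [Fintype.card_fin] at hle
  have hd : ‖x - x'‖ < δ / Real.sqrt 3 := by rwa [Metric.mem_ball, dist_eq_norm] at hxx'
  calc Torus.euclidDist x x' ≤ Real.sqrt (3 : ℕ) * ‖x - x'‖ := hle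
    _ ≤ Real.sqrt 3 * (δ / Real.sqrt 3) := by
        push_cast
        exact mul_le_mul_of_nonneg_left hd.le h3.le
    _ = δ := by field_simp

theorem exists_time_net {t δ : ℝ} (ht : 0 ≤ t) (hδ : 0 < δ) :
    ∃ St : Finset ℝ, (∀ s ∈ St, s ∈ Icc 0 t) ∧ ∀ s ∈ Icc 0 t, ∃ s' ∈ St, |s - s'| ≤ δ := by
  obtain ⟨M, hM⟩ := exists_nat_gt (t / δ)
  have hMpos : (0 : ℝ) < M := lt_of_le_of_lt (div_nonneg ht hδ.le) hM
  have hstep : t / M ≤ δ := by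
    rw [div_le_iff₀ hMpos]
    have := (div_lt_iff₀ hδ).1 hM
    linarith
  refine ⟨(Finset.range (M + 1)).image fun k : ℕ => (k : ℝ) * (t / M), ?_, ?_⟩
  · intro s hs
    obtain ⟨k, hk, rfl⟩ := Finset.mem_image.1 hs
    have hkM : (k : ℝ) ≤ M := by exact_mod_cast Nat.lt_succ_iff.1 (Finset.mem_range.1 hk)
    refine ⟨by positivity, ?_⟩
    calc (k : ℝ) * (t / M) ≤ M * (t / M) := by gcongr
      _ = t := by field_simp
  · intro s hs
    rcases eq_or_lt_of_le ht with rfl | htpos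
    · refine ⟨0, Finset.mem_image.2 ⟨0, by simp, by simp⟩, ?_⟩
      have : s = 0 := le_antisymm hs.2 hs.1
      simp [this, hδ.le]
    · have hh : 0 < t / M := div_pos htpos hMpos
      set k := ⌊s / (t / M)⌋₊ with hk
      have hks : (k : ℝ) * (t / M) ≤ s := by
        have := Nat.floor_le (div_nonneg hs.1 hh.le)
        rw [← hk] at this
        calc (k : ℝ) * (t / M) ≤ s / (t / M) * (t / M) := by gcongr
          _ = s := by field_simp
      have hsk : s < ((k : ℝ) + 1) * (t / M) := by
        have := Nat.lt_floor_add_one (s / (t / M))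
        rw [← hk] at this
        calc s = s / (t / M) * (t / M) := by field_simp
          _ < ((k : ℝ) + 1) * (t / M) := by gcongr
      have hkM : k ≤ M := by
        have h1 : (k : ℝ) * (t / M) ≤ t := hks.trans hs.2
        have h2 : (k : ℝ) ≤ M := by
          by_contra hlt
          rw [not_le] at hlt
          have : (M : ℝ) * (t / M) < k * (t / M) := by gcongr
          rw [show (M : ℝ) * (t / M) = t by field_simp] at this
          linarith
        exact_mod_cast h2
      refine ⟨(k : ℝ) * (t / M), Finset.mem_image.2 ⟨k, Finset.mem_range.2 (Nat.lt_succ_of_le hkM), rfl⟩, ?_⟩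
      rw [abs_of_nonneg (by linarith)]
      calc s - k * (t / M) ≤ t / M := by nlinarith
        _ ≤ δ := hstep

/-! ## §2 Kernel glue (gen-1 §7, copied; triangle inequality re-proved to keep imports light) -/

theorem euclidDist_triangle'' (x y w : T3) :
    Torus.euclidDist x w ≤ Torus.euclidDist x y + Torus.euclidDist y w := by
  have hproj : Literature.Analysis.FunctionSpaces.Torus.proj (Torus.reprSym (x - y) + Torus.reprSym (y - w)) =
      x - w := by
    rw [Literature.Analysis.FunctionSpaces.Torus.proj_add, Torus.proj_reprSym, Torus.proj_reprSym]
    abel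
  rw [Torus.euclidDist_eq, Torus.euclidDist_eq, Torus.euclidDist_eq]
  exact (Torus.norm_reprSym_le_of_proj_eq hproj).trans (norm_add_le _ _)

theorem cone_lipschitz_centre {r : ℝ} (hr : 0 < r) (q x x' : T3) :
    |cone r q x - cone r q x'| ≤ 3 / (Real.pi * r ^ 4) * Torus.euclidDist x x' := by
  unfold cone
  have hc : 0 ≤ 3 / (Real.pi * r ^ 3) := by positivity
  have htri : |Torus.euclidDist q x - Torus.euclidDist q x'| ≤ Torus.euclidDist x x' := by
    rw [abs_sub_le_iff]
    constructor
    · have := euclidDist_triangle'' q x' x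
      rw [Torus.euclidDist_comm x' x] at this
      linarith
    · have := euclidDist_triangle'' q x x'
      linarith
  rw [← mul_sub, abs_mul, abs_of_nonneg hc]
  calc 3 / (Real.pi * r ^ 3) * |max (1 - Torus.euclidDist q x / r) 0 - max (1 - Torus.euclidDist q x' / r) 0|
      ≤ 3 / (Real.pi * r ^ 3) * |(1 - Torus.euclidDist q x / r) - (1 - Torus.euclidDist q x' / r)| :=
        mul_le_mul_of_nonneg_left (abs_max_sub_max_le_abs _ _ _) hc
    _ = 3 / (Real.pi * r ^ 3) * (|Torus.euclidDist q x - Torus.euclidDist q x'| / r) := by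
        rw [show (1 - Torus.euclidDist q x / r) - (1 - Torus.euclidDist q x' / r) =
          -((Torus.euclidDist q x - Torus.euclidDist q x') / r) by ring, abs_neg, abs_div, abs_of_pos hr]
    _ ≤ 3 / (Real.pi * r ^ 3) * (Torus.euclidDist x x' / r) := by gcongr
    _ = 3 / (Real.pi * r ^ 4) * Torus.euclidDist x x' := by
        field_simp

theorem cone_lipschitz_particle {r : ℝ} (hr : 0 < r) (q q' x : T3) :
    |cone r q x - cone r q' x| ≤ 3 / (Real.pi * r ^ 4) * Torus.euclidDist q q' := by
  have hsymm : ∀ a b : T3, cone r a b = cone r b a := fun a b => by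
    unfold cone; rw [Torus.euclidDist_comm]
  rw [hsymm q x, hsymm q' x]
  exact cone_lipschitz_centre hr x q q'

theorem mollDensity_lipschitz_centre {r : ℝ} (hr : 0 < r) {n : ℕ} (w : Config n (Fin 3) T3) (x x' : T3) :
    |mollDensity r w x - mollDensity r w x'| ≤ 3 / (Real.pi * r ^ 4) * Torus.euclidDist x x' := by
  rw [mollDensity_eq, mollDensity_eq, ← mul_sub, ← Finset.sum_sub_distrib, abs_mul,
    abs_of_nonneg (inv_nonneg.2 (Nat.cast_nonneg n))]
  rcases Nat.eq_zero_or_pos n with hn | hn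
  · subst hn
    simp only [Nat.cast_zero, inv_zero, zero_mul]
    exact mul_nonneg (by positivity) (norm_nonneg _)
  · calc (n : ℝ)⁻¹ * |∑ i, (cone r (w i).1 x - cone r (w i).1 x')|
        ≤ (n : ℝ)⁻¹ * ∑ i, |cone r (w i).1 x - cone r (w i).1 x'| := by
          gcongr
          exact Finset.abs_sum_le_sum_abs _ _
      _ ≤ (n : ℝ)⁻¹ * ∑ _i : Fin n, 3 / (Real.pi * r ^ 4) * Torus.euclidDist x x' := by
          gcongr with i _
          exact cone_lipschitz_centre hr _ _ _
      _ = 3 / (Real.pi * r ^ 4) * Torus.euclidDist x x' := by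
          rw [Finset.sum_const, Finset.card_univ, Fintype.card_fin, nsmul_eq_mul, ← mul_assoc,
            inv_mul_cancel₀ (by exact_mod_cast hn.ne'), one_mul]

theorem clock_of_meanDisplacement {r : ℝ} (hr : 0 < r) {n : ℕ} (w w' : Config n (Fin 3) T3) (x₀ : T3) {B : ℝ}
    (hdisp : (n : ℝ)⁻¹ * ∑ i, Torus.euclidDist ((w' i).1) ((w i).1) ≤ B) :
    |mollDensity r w' x₀ - mollDensity r w x₀| ≤ 3 / (Real.pi * r ^ 4) * B := by
  rw [mollDensity_eq, mollDensity_eq, ← mul_sub, ← Finset.sum_sub_distrib, abs_mul,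
    abs_of_nonneg (inv_nonneg.2 (Nat.cast_nonneg n))]
  have hc : 0 ≤ 3 / (Real.pi * r ^ 4) := by positivity
  calc (n : ℝ)⁻¹ * |∑ i, (cone r (w' i).1 x₀ - cone r (w i).1 x₀)|
      ≤ (n : ℝ)⁻¹ * ∑ i, |cone r (w' i).1 x₀ - cone r (w i).1 x₀| := by
        gcongr
        exact Finset.abs_sum_le_sum_abs _ _
    _ ≤ (n : ℝ)⁻¹ * ∑ i, 3 / (Real.pi * r ^ 4) * Torus.euclidDist (w' i).1 (w i).1 := by
        gcongr with i _
        exact cone_lipschitz_particle hr _ _ _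
    _ = 3 / (Real.pi * r ^ 4) * ((n : ℝ)⁻¹ * ∑ i, Torus.euclidDist (w' i).1 (w i).1) := by
        rw [← Finset.mul_sum]
        ring
    _ ≤ 3 / (Real.pi * r ^ 4) * B := mul_le_mul_of_nonneg_left hdisp hc

/-! ## §3 STUB D (gen-1 drefute's proof, copied verbatim) -/

theorem stub_capEventSubset {ε : ℝ} {n : ℕ} (Ψ : HardSphereFlow (Torus.geometry (Fin 3)) ε n)
    (ρ : ℝ → T3 → ℝ) {t η r r₀ τ₀ K δx δt : ℝ} (hr : 0 < r)
    (hclock : ∀ z ∈ Ψ.good, ∀ (s s' : ℝ) (x₀ : T3),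
      |mollDensity r (Ψ.flow s' z) x₀ - mollDensity r (Ψ.flow s z) x₀| ≤
        3 / (Real.pi * r ^ 4) * Real.sqrt (2 * ((n : ℝ)⁻¹ * configEnergy z)) * |s' - s|)
    (hlip : ∀ (w : Config n (Fin 3) T3) (x x' : T3),
      |mollDensity r w x - mollDensity r w x'| ≤ 3 / (Real.pi * r ^ 4) * Torus.euclidDist x x')
    (hmod1 : ∀ s ∈ Icc 0 t, ∀ x : T3, ∫ y, cone r y x * ρ s y ≤ ρ s x + η / 4)
    (hmod2 : ∀ s ∈ Icc 0 t, ∀ s' ∈ Icc 0 t, |s - s'| ≤ τ₀ →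
      ∀ x x' : T3, Torus.euclidDist x x' ≤ r₀ → |ρ s x - ρ s' x'| ≤ η / 4)
    (Sx : Finset T3) (hSx : ∀ x : T3, ∃ x' ∈ Sx, Torus.euclidDist x x' ≤ δx)
    (hδx₁ : δx ≤ r₀) (hδx₂ : 3 / (Real.pi * r ^ 4) * δx ≤ η / 8)
    (St : Finset ℝ) (hSt : ∀ s ∈ St, s ∈ Icc 0 t) (hSt' : ∀ s ∈ Icc 0 t, ∃ s' ∈ St, |s - s'| ≤ δt)
    (hδt₁ : δt ≤ τ₀) (hδt₂ : 3 / (Real.pi * r ^ 4) * Real.sqrt (2 * K) * δt ≤ η / 8) :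
    {z | ∃ s ∈ Icc 0 t, ∃ x : T3, ρ s x + η < mollDensity r (Ψ.flow s z) x} ∩ Ψ.good ∩
        {z | (n : ℝ)⁻¹ * configEnergy z ≤ K} ⊆
      ⋃ s ∈ St, ⋃ x ∈ Sx, {z | η / 4 < |empiricalDensityField (Ψ.flow s z) (fun y => cone r y x) -
        ∫ y, cone r y x * ρ s y|} := by
  rintro z ⟨⟨⟨s, hs, x, hx⟩, hg⟩, hKz⟩
  have hKz' : (n : ℝ)⁻¹ * configEnergy z ≤ K := hKz
  obtain ⟨sk, hsk, hssk⟩ := hSt' s hs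
  obtain ⟨xl, hxl, hxxl⟩ := hSx x
  simp only [Set.mem_iUnion, Set.mem_setOf_eq, exists_prop]
  refine ⟨sk, hsk, xl, hxl, ?_⟩
  have hc : 0 ≤ 3 / (Real.pi * r ^ 4) := by positivity
  have h1 : |mollDensity r (Ψ.flow sk z) x - mollDensity r (Ψ.flow s z) x| ≤ η / 8 := by
    refine (hclock z hg s sk x).trans ?_
    have hsqrt : Real.sqrt (2 * ((n : ℝ)⁻¹ * configEnergy z)) ≤ Real.sqrt (2 * K) :=
      Real.sqrt_le_sqrt (by linarith)
    have habs : |sk - s| ≤ δt := by rw [abs_sub_comm]; exact hssk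
    calc 3 / (Real.pi * r ^ 4) * Real.sqrt (2 * ((n : ℝ)⁻¹ * configEnergy z)) * |sk - s|
        ≤ 3 / (Real.pi * r ^ 4) * Real.sqrt (2 * K) * δt :=
          mul_le_mul (mul_le_mul_of_nonneg_left hsqrt hc) habs (abs_nonneg _)
            (mul_nonneg hc (Real.sqrt_nonneg _))
      _ ≤ η / 8 := hδt₂
  have h2 : |mollDensity r (Ψ.flow sk z) x - mollDensity r (Ψ.flow sk z) xl| ≤ η / 8 := by
    refine (hlip _ x xl).trans ?_
    calc 3 / (Real.pi * r ^ 4) * Torus.euclidDist x xl ≤ 3 / (Real.pi * r ^ 4) * δx :=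
          mul_le_mul_of_nonneg_left hxxl hc
      _ ≤ η / 8 := hδx₂
  have h3 : |ρ s x - ρ sk xl| ≤ η / 4 :=
    hmod2 s hs sk (hSt sk hsk) (hssk.trans hδt₁) x xl (hxxl.trans hδx₁)
  have h4 : ∫ y, cone r y xl * ρ sk y ≤ ρ sk xl + η / 4 := hmod1 sk (hSt sk hsk) xl
  have hed : empiricalDensityField (Ψ.flow sk z) (fun y => cone r y xl) = mollDensity r (Ψ.flow sk z) xl := rfl
  rw [hed]
  rw [abs_le] at h1 h2 h3
  refine lt_of_lt_of_le ?_ (le_abs_self _)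
  linarith [h1.1, h1.2, h2.1, h2.2, h3.1, h3.2]

/-! ## §4 The bad set is null (skeleton §2, copied) -/

theorem localGibbsLaw_compl_good (σ : ℝ) (a₀ θ₀ : T3 → ℝ) (u₀ : T3 → V3) (N : ℕ)
    (Ψ : HardSphereFlow (Torus.geometry (Fin 3)) (hsDiameter σ N) (N + 1)) :
    localGibbsLaw σ a₀ u₀ θ₀ N Ψ Ψ.goodᶜ = 0 := by
  have hL : localGibbsLaw σ a₀ u₀ θ₀ N Ψ =
      (liouville (Torus.geometry (Fin 3)) (N + 1) (hsDiameter σ N)).withDensity fun z => ENNReal.ofReal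
        (canonicalDensity (Torus.geometry (Fin 3)) (hsDiameter σ N) (N + 1) (localGibbsProfile a₀ u₀ θ₀) z) := rfl
  rw [hL]
  exact withDensity_absolutelyContinuous _ _ Ψ.measure_compl_good

/-! ## §5 STUB E — the assembly (new) -/

/-- **STUB E — `stub_gridUpgrade`, verbatim signature.** -/
theorem stub_gridUpgrade {σ : ℝ} (a₀ θ₀ : T3 → ℝ) (u₀ : T3 → V3) (Φ : Flows σ) (ρ : ℝ → T3 → ℝ)
    {t : ℝ} (ht : 0 ≤ t)
    (hdisp : ∀ N : ℕ, ∀ z ∈ (Φ N).good, ∀ s s' : ℝ,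
      ((N + 1 : ℕ) : ℝ)⁻¹ * ∑ i, Torus.euclidDist (((Φ N).flow s' z i).1) (((Φ N).flow s z i).1) ≤
        Real.sqrt (2 * (((N + 1 : ℕ) : ℝ)⁻¹ * configEnergy z)) * |s' - s|)
    {K : ℝ}
    (hK : Tendsto (fun N => localGibbsLaw σ a₀ u₀ θ₀ N (Φ N)
      {z | K < ((N + 1 : ℕ) : ℝ)⁻¹ * configEnergy z}) atTop (𝓝 0))
    (hmod : ∀ η : ℝ, 0 < η → ∃ r₀ : ℝ, 0 < r₀ ∧ r₀ ≤ 1 / 2 ∧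
      (∀ r : ℝ, 0 < r → r < r₀ → ∀ s ∈ Icc 0 t, ∀ x : T3, ∫ y, cone r y x * ρ s y ≤ ρ s x + η) ∧
      ∃ τ₀ : ℝ, 0 < τ₀ ∧ ∀ s ∈ Icc 0 t, ∀ s' ∈ Icc 0 t, |s - s'| ≤ τ₀ →
        ∀ x x' : T3, Torus.euclidDist x x' ≤ r₀ → |ρ s x - ρ s' x'| ≤ η)
    (hlln : ∀ s ∈ Icc 0 t, ∀ χ : T3 → ℝ, Continuous χ → ∀ δ : ℝ, 0 < δ →
      Tendsto (fun N => localGibbsLaw σ a₀ u₀ θ₀ N (Φ N)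
        {z | δ < |empiricalDensityField ((Φ N).flow s z) χ - ∫ x, χ x * ρ s x|}) atTop (𝓝 0)) :
    CapLimit σ a₀ u₀ θ₀ Φ ρ t := by
  intro η δ hη hδ
  obtain ⟨r₀, hr₀, -, hmod1, τ₀, hτ₀, hmod2⟩ := hmod (η / 4) (by positivity)
  refine ⟨r₀, hr₀, fun r hr hrr₀ => ?_⟩
  -- the Lipschitz constant of the kernel and the two meshes
  set L : ℝ := 3 / (Real.pi * r ^ 4) with hL
  have hLpos : 0 < L := by positivity
  set δx : ℝ := min r₀ (η / 8 / L) with hδx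
  have hδxpos : 0 < δx := lt_min hr₀ (by positivity)
  set δt : ℝ := min τ₀ (η / 8 / (L * (Real.sqrt (2 * K) + 1))) with hδt
  have hsq1 : 0 < Real.sqrt (2 * K) + 1 := by positivity
  have hδtpos : 0 < δt := lt_min hτ₀ (by positivity)
  obtain ⟨Sx, hSx⟩ := exists_euclidDist_net hδxpos
  obtain ⟨St, hSt, hSt'⟩ := exists_time_net ht hδtpos
  have hδx₁ : δx ≤ r₀ := min_le_left _ _
  have hδx₂ : L * δx ≤ η / 8 := by
    calc L * δx ≤ L * (η / 8 / L) := mul_le_mul_of_nonneg_left (min_le_right _ _) hLpos.le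
      _ = η / 8 := by field_simp
  have hδt₁ : δt ≤ τ₀ := min_le_left _ _
  have hδt₂ : L * Real.sqrt (2 * K) * δt ≤ η / 8 := by
    calc L * Real.sqrt (2 * K) * δt ≤ L * (Real.sqrt (2 * K) + 1) * δt := by
          gcongr
          linarith
      _ ≤ L * (Real.sqrt (2 * K) + 1) * (η / 8 / (L * (Real.sqrt (2 * K) + 1))) :=
          mul_le_mul_of_nonneg_left (min_le_right _ _) (by positivity)
      _ = η / 8 := by field_simp
  -- notation for the laws and the grid events
  set P : (N : ℕ) → Measure (Config (N + 1) (Fin 3) T3) := fun N => localGibbsLaw σ a₀ u₀ θ₀ N (Φ N) with hP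
  set G : (N : ℕ) → ℝ → T3 → Set (Config (N + 1) (Fin 3) T3) := fun N s x =>
    {z | η / 4 < |empiricalDensityField ((Φ N).flow s z) (fun y => cone r y x) - ∫ y, cone r y x * ρ s y|}
    with hG
  -- the sure inclusion at every N (STUB D fed with the clock from `hdisp`)
  have hincl : ∀ N : ℕ, capEvent Φ N ρ t η r ⊆
      ((Φ N).goodᶜ ∪ {z | K < ((N + 1 : ℕ) : ℝ)⁻¹ * configEnergy z}) ∪ ⋃ s ∈ St, ⋃ x ∈ Sx, G N s x := by
    intro N z hz
    by_cases hg : z ∈ (Φ N).good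
    · by_cases hKz : ((N + 1 : ℕ) : ℝ)⁻¹ * configEnergy z ≤ K
      · right
        have hclock : ∀ z ∈ (Φ N).good, ∀ (s s' : ℝ) (x₀ : T3),
            |mollDensity r ((Φ N).flow s' z) x₀ - mollDensity r ((Φ N).flow s z) x₀| ≤
              3 / (Real.pi * r ^ 4) * Real.sqrt (2 * (((N + 1 : ℕ) : ℝ)⁻¹ * configEnergy z)) * |s' - s| := by
          intro z hz s s' x₀
          rw [mul_assoc]
          exact clock_of_meanDisplacement hr _ _ x₀ (hdisp N z hz s s')
        exact stub_capEventSubset (Φ N) ρ hr hclock (mollDensity_lipschitz_centre hr) (hmod1 r hr hrr₀) hmod2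
          Sx hSx hδx₁ hδx₂ St hSt hSt' hδt₁ hδt₂ ⟨⟨hz, hg⟩, hKz⟩
      · exact Or.inl (Or.inr (not_le.1 hKz))
    · exact Or.inl (Or.inl hg)
  -- union bound on the outer measure
  have hbound : ∀ N : ℕ, P N (capEvent Φ N ρ t η r) ≤
      P N {z | K < ((N + 1 : ℕ) : ℝ)⁻¹ * configEnergy z} + ∑ s ∈ St, ∑ x ∈ Sx, P N (G N s x) := by
    intro N
    calc P N (capEvent Φ N ρ t η r)
        ≤ P N (((Φ N).goodᶜ ∪ {z | K < ((N + 1 : ℕ) : ℝ)⁻¹ * configEnergy z}) ∪ ⋃ s ∈ St, ⋃ x ∈ Sx, G N s x) :=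
          measure_mono (hincl N)
      _ ≤ P N ((Φ N).goodᶜ ∪ {z | K < ((N + 1 : ℕ) : ℝ)⁻¹ * configEnergy z}) +
            P N (⋃ s ∈ St, ⋃ x ∈ Sx, G N s x) := measure_union_le _ _
      _ ≤ (P N (Φ N).goodᶜ + P N {z | K < ((N + 1 : ℕ) : ℝ)⁻¹ * configEnergy z}) +
            ∑ s ∈ St, P N (⋃ x ∈ Sx, G N s x) :=
          add_le_add (measure_union_le _ _) (measure_biUnion_finset_le St _)
      _ ≤ (0 + P N {z | K < ((N + 1 : ℕ) : ℝ)⁻¹ * configEnergy z}) + ∑ s ∈ St, ∑ x ∈ Sx, P N (G N s x) := by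
          gcongr with s _
          · exact le_of_eq (localGibbsLaw_compl_good σ a₀ θ₀ u₀ N (Φ N))
          · exact measure_biUnion_finset_le Sx _
      _ = _ := by rw [zero_add]
  -- every term tends to zero
  have hGlim : ∀ s ∈ St, ∀ x ∈ Sx, Tendsto (fun N => P N (G N s x)) atTop (𝓝 0) := by
    intro s hs x _
    exact hlln s (hSt s hs) (fun y => cone r y x) (continuous_cone_left r x) (η / 4) (by positivity)
  have hsum : Tendsto (fun N => ∑ s ∈ St, ∑ x ∈ Sx, P N (G N s x)) atTop (𝓝 0) := by
    have h := tendsto_finsetSum St fun s hs => tendsto_finsetSum Sx fun x hx => hGlim s hs x hx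
    simpa using h
  have htot : Tendsto (fun N => P N {z | K < ((N + 1 : ℕ) : ℝ)⁻¹ * configEnergy z} +
      ∑ s ∈ St, ∑ x ∈ Sx, P N (G N s x)) atTop (𝓝 0) := by
    simpa using hK.add hsum
  -- `Tendsto ⇒ ∃ N₀`
  have hδ' : (0 : ℝ≥0∞) < ENNReal.ofReal δ := ENNReal.ofReal_pos.2 hδ
  obtain ⟨N₀, hN₀⟩ := eventually_atTop.1 (htot.eventually (Iio_mem_nhds hδ'))
  refine ⟨N₀, fun N hN => ?_⟩
  exact ((hbound N).trans (le_of_lt (hN₀ N hN)))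


/-! ## §G The skeleton's glue and composition (copied verbatim from `Lines/lipschitz-clock-free-past-cap.lean`) -/

/-- The torus hard-sphere geometry in dimension `3`. -/
abbrev G3 : Geometry (Fin 3) T3 := Torus.geometry (Fin 3)

/-- Kinetic energy PER PARTICLE of a configuration, `n⁻¹ · ½ ∑ᵢ |vᵢ|²`; conserved along hard-sphere trajectories. -/
def kinEnergy {n : ℕ} (w : Config n (Fin 3) T3) : ℝ :=
  (n : ℝ)⁻¹ * configEnergy w

/-- The FIXED-TIME density law of large numbers at every `s ∈ [0, t]`, for laws `P N` and flows `Φ N`. -/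
def DensityLLNUpTo (P : (N : ℕ) → Measure (Config (N + 1) (Fin 3) T3)) {σ : ℝ} (Φ : Flows σ)
    (ρ : ℝ → T3 → ℝ) (t : ℝ) : Prop :=
  ∀ s ∈ Icc 0 t, ∀ χ : T3 → ℝ, Continuous χ → ∀ δ : ℝ, 0 < δ →
    Tendsto (fun N => P N {z | δ < |empiricalDensityField ((Φ N).flow s z) χ - ∫ x, χ x * ρ s x|})
      atTop (𝓝 0)

/-- Kinetic energy per particle = the empirical energy field tested against `χ ≡ 1`. -/
theorem kinEnergy_eq_empiricalEnergyField {n : ℕ} (w : Config n (Fin 3) T3) :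
    kinEnergy w = empiricalEnergyField w (fun _ => 1) := by
  unfold kinEnergy empiricalEnergyField configEnergy
  rw [integral_empiricalMeasure]
  congr 1
  rw [Finset.mul_sum]
  refine Finset.sum_congr rfl fun i _ => ?_
  ring

/-- **Energy tightness from the tie** (the `χ ≡ 1` energy instance of the `t = 0` law of large numbers): the
kinetic energy per particle exceeds `∫ E(0) + 1` only with vanishing probability. On the good set `Φ_0 = id` and
`empiricalEnergyField z 1 = kinEnergy z`; the bad set is null. -/
theorem energyTight_of_tie {σ : ℝ} {a₀ θ₀ : T3 → ℝ} {u₀ : T3 → V3} {ρ θ : ℝ → T3 → ℝ} {u : ℝ → T3 → V3}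
    (Φ : Flows σ) (h0 : TendstoHydroFieldsAt (fun N => localGibbsLaw σ a₀ u₀ θ₀ N (Φ N)) Φ ρ u θ 0) :
    Tendsto (fun N => localGibbsLaw σ a₀ u₀ θ₀ N (Φ N)
      {z | (∫ x, totalEnergyDensity (ρ 0 x) (u 0 x) (θ 0 x)) + 1 < kinEnergy z}) atTop (𝓝 0) := by
  set E₀ : ℝ := ∫ x, totalEnergyDensity (ρ 0 x) (u 0 x) (θ 0 x) with hE₀
  have h := (h0 (fun _ => (1 : ℝ)) continuous_const 1 one_pos).2.2
  have hE : (∫ x, (fun _ : T3 => (1 : ℝ)) x * totalEnergyDensity (ρ 0 x) (u 0 x) (θ 0 x)) = E₀ := by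
    simp only [one_mul, hE₀]
  refine tendsto_of_tendsto_of_tendsto_of_le_of_le tendsto_const_nhds h (fun _ => zero_le) fun N => ?_
  set P := localGibbsLaw σ a₀ u₀ θ₀ N (Φ N) with hP
  have hsub : {z : Config (N + 1) (Fin 3) T3 | E₀ + 1 < kinEnergy z} ⊆
      ({z | E₀ + 1 < kinEnergy z} ∩ (Φ N).good) ∪ (Φ N).goodᶜ := by
    intro z hz
    by_cases hg : z ∈ (Φ N).good
    · exact Or.inl ⟨hz, hg⟩
    · exact Or.inr hg
  have hincl : {z : Config (N + 1) (Fin 3) T3 | E₀ + 1 < kinEnergy z} ∩ (Φ N).good ⊆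
      {z | (1 : ℝ) < |empiricalEnergyField ((Φ N).flow 0 z) (fun _ => (1 : ℝ)) -
        ∫ x, (fun _ : T3 => (1 : ℝ)) x * totalEnergyDensity (ρ 0 x) (u 0 x) (θ 0 x)|} := by
    rintro z ⟨hz, hg⟩
    have hz' : E₀ + 1 < kinEnergy z := hz
    show (1 : ℝ) < |empiricalEnergyField ((Φ N).flow 0 z) (fun _ => (1 : ℝ)) -
        ∫ x, (fun _ : T3 => (1 : ℝ)) x * totalEnergyDensity (ρ 0 x) (u 0 x) (θ 0 x)|
    rw [(Φ N).flow_zero z hg, ← kinEnergy_eq_empiricalEnergyField, hE]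
    exact lt_of_lt_of_le (by linarith) (le_abs_self _)
  calc P {z | E₀ + 1 < kinEnergy z}
      ≤ P ({z | E₀ + 1 < kinEnergy z} ∩ (Φ N).good) + P (Φ N).goodᶜ :=
        (measure_mono hsub).trans (measure_union_le _ _)
    _ ≤ P {z | (1 : ℝ) < |empiricalEnergyField ((Φ N).flow 0 z) (fun _ => (1 : ℝ)) -
          ∫ x, (fun _ : T3 => (1 : ℝ)) x * totalEnergyDensity (ρ 0 x) (u 0 x) (θ 0 x)|} + 0 :=
        add_le_add (measure_mono hincl) (le_of_eq (localGibbsLaw_compl_good σ a₀ θ₀ u₀ N (Φ N)))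
    _ = _ := add_zero _

/-- **The dock** (pure logic): the packing-guarded band limit (stmt-9133) and dilute self-consistency (stmt-3091)
give the density LLN at every `s ≤ t < T` for every tied classical solution, `σ < min σ₁ σ₃`. -/
theorem densityLLNUpTo_of_band {η₀ : ℝ} {a₀ θ₀ : T3 → ℝ} {u₀ : T3 → V3} {σ₁ σ₃ σ : ℝ}
    (h1 : ∀ σ : ℝ, 0 < σ → σ < σ₁ → ∀ (T : ℝ) (ρ θ : ℝ → T3 → ℝ) (u : ℝ → T3 → V3),
      IsHardSphereEulerSolution σ T ρ u θ → (∀ t ∈ Ico 0 T, ∀ x, ρ t x * σ ^ 3 < η₀) →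
      ∀ Φ : Flows σ, TendstoHydroFieldsAt (fun N => localGibbsLaw σ a₀ u₀ θ₀ N (Φ N)) Φ ρ u θ 0 →
      ∀ t ∈ Ico 0 T, TendstoHydroFieldsAt (fun N => localGibbsLaw σ a₀ u₀ θ₀ N (Φ N)) Φ ρ u θ t)
    (h3 : ∀ σ : ℝ, 0 < σ → σ < σ₃ → ∀ (T : ℝ) (ρ θ : ℝ → T3 → ℝ) (u : ℝ → T3 → V3),
      IsHardSphereEulerSolution σ T ρ u θ →
      ∀ Φ : Flows σ, TendstoHydroFieldsAt (fun N => localGibbsLaw σ a₀ u₀ θ₀ N (Φ N)) Φ ρ u θ 0 →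
      ∀ t ∈ Ico 0 T, ∀ x, ρ t x * σ ^ 3 < η₀)
    (hσ : 0 < σ) (hσ1 : σ < σ₁) (hσ3 : σ < σ₃) {T : ℝ} {ρ θ : ℝ → T3 → ℝ} {u : ℝ → T3 → V3}
    (hE : IsHardSphereEulerSolution σ T ρ u θ) (Φ : Flows σ)
    (h0 : TendstoHydroFieldsAt (fun N => localGibbsLaw σ a₀ u₀ θ₀ N (Φ N)) Φ ρ u θ 0)
    {t : ℝ} (ht : t ∈ Ico 0 T) :
    DensityLLNUpTo (fun N => localGibbsLaw σ a₀ u₀ θ₀ N (Φ N)) Φ ρ t := by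
  intro s hs χ hχ δ hδ
  have hguard : ∀ t ∈ Ico 0 T, ∀ x, ρ t x * σ ^ 3 < η₀ := h3 σ hσ hσ3 T ρ θ u hE Φ h0
  exact (h1 σ hσ hσ1 T ρ θ u hE hguard Φ h0 s ⟨hs.1, lt_of_le_of_lt hs.2 ht.2⟩ χ hχ δ hδ).1

/-- **The cap for ONE tied classical solution from the density LLN on `[0, t]`** (the stubs composed; this is the
per-instance statement every dock shares): STUB E fed with STUB A (per `N`), the energy tightness of the tie, STUB B
and the fixed-time density LLN at every `s ≤ t`. -/
theorem capLimit_of_densityLLNUpTo {σ : ℝ} {a₀ θ₀ : T3 → ℝ} {u₀ : T3 → V3} {T : ℝ} {ρ θ : ℝ → T3 → ℝ}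
    {u : ℝ → T3 → V3} (hE : IsHardSphereEulerSolution σ T ρ u θ) (Φ : Flows σ)
    (h0 : TendstoHydroFieldsAt (fun N => localGibbsLaw σ a₀ u₀ θ₀ N (Φ N)) Φ ρ u θ 0)
    {t : ℝ} (ht : t ∈ Ico 0 T) (hlln : DensityLLNUpTo (fun N => localGibbsLaw σ a₀ u₀ θ₀ N (Φ N)) Φ ρ t) :
    CapLimit σ a₀ u₀ θ₀ Φ ρ t :=
  stub_gridUpgrade a₀ θ₀ u₀ Φ ρ ht.1 (fun N _ hz s s' => stub_meanDisplacement (Φ N) hz s s')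
    (energyTight_of_tie Φ h0) (stub_eulerDensityModulus hE.smooth_density ht) hlln

/-! ## §3 Composition (audited): the stubs + the dock give the crux BY NAME -/

/-- **`DensityCap` from the line `lipschitz-clock-free-past-cap`** (kernel-checked composition, no `sorry` of its
own): hypotheses = the route items `ImplosionDichotomy.HydroLimitInBand` (stmt-9133) and
`JParityClosure.DiluteSelfConsistency` (stmt-3091); per profile `σ₀ := min σ₁ σ₃`; for a tied classical solution and
`t < T` the dock gives the density LLN on `[0, t]`, and `capLimit_of_densityLLNUpTo` the uniform-in-`(s, x)` cap
(`CapLimit`, definitionally the crux's conclusion block: `densityCap_iff`). -/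
theorem DensityCap_of (hB : Theses.ImplosionDichotomy.HydroLimitInBand)
    (hD : Theses.JParityClosure.DiluteSelfConsistency) : Theses.JParityClosure.DensityCap := by
  refine densityCap_iff.2 ?_
  intro a₀ θ₀ u₀ ha hθ hu ha0 hθ0
  obtain ⟨η₀, hη₀, hIB⟩ := hB
  obtain ⟨σ₁, hσ₁, h1⟩ := hIB a₀ θ₀ u₀ ha hθ hu ha0 hθ0
  obtain ⟨σ₃, hσ₃, h3⟩ := hD η₀ hη₀ a₀ θ₀ u₀ ha hθ hu ha0 hθ0
  refine ⟨min σ₁ σ₃, lt_min hσ₁ hσ₃, ?_⟩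
  intro σ hσ hσlt T ρ θ u hE Φ h0 t ht
  have hσ1 : σ < σ₁ := lt_of_lt_of_le hσlt (min_le_left _ _)
  have hσ3 : σ < σ₃ := lt_of_lt_of_le hσlt (min_le_right _ _)
  exact capLimit_of_densityLLNUpTo hE Φ h0 ht (densityLLNUpTo_of_band h1 h3 hσ hσ1 hσ3 hE Φ h0 ht)

/-- **The corollary status of the crux** (Disproof §6 near-miss `densityCap_of_hydrodynamicLimit`, now proved modulo
the same registered stubs): the summit conjunct gives the fixed-time LLN at every `s < T` unguarded, hence the cap. -/
theorem densityCap_of_hydrodynamicLimit (hHL : _root_.HydrodynamicLimit) : Theses.JParityClosure.DensityCap := by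
  refine densityCap_iff.2 ?_
  intro a₀ θ₀ u₀ ha hθ hu ha0 hθ0
  obtain ⟨σ₀, hσ₀, hHL⟩ := hHL a₀ θ₀ u₀ ha hθ hu ha0 hθ0
  refine ⟨σ₀, hσ₀, ?_⟩
  intro σ hσ hσlt T ρ θ u hE Φ h0 t ht
  refine capLimit_of_densityLLNUpTo hE Φ h0 ht ?_
  intro s hs χ hχ δ hδ
  exact (hHL σ hσ hσlt T ρ θ u hE Φ h0 s ⟨hs.1, lt_of_le_of_lt hs.2 ht.2⟩ χ hχ δ hδ).1


/-! ## §H The Disproof's two near-misses, now closed -/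

/-- **Disproof §6 near-miss 2, PROVED: the equilibrium instance of the crux holds unconditionally.** For the
homogeneous profiles `(1,1,0)` and `σ < σ₁` (`tendstoHydroFieldsAt_homogeneous`, landed `Negative/Equilibrium.lean`),
every flow family and the tied constant state `(1,0,1)`: `CapLimit σ 1 0 1 Φ 1 t` for every `t ≥ 0` — so the crux's
conclusion block is satisfiable by a genuine (non-junk) instance. -/
theorem capLimit_homogeneous :
    ∃ σ₁ : ℝ, 0 < σ₁ ∧ ∀ σ : ℝ, 0 < σ → σ < σ₁ → ∀ Φ : Flows σ, ∀ t : ℝ, 0 ≤ t →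
      CapLimit σ (fun _ => 1) (fun _ => 0) (fun _ => 1) Φ (fun _ _ => 1) t := by
  obtain ⟨σ₁, hσ₁, -, H⟩ := tendstoHydroFieldsAt_homogeneous
  refine ⟨σ₁, hσ₁, fun σ hσ hσ1 Φ t ht => ?_⟩
  have hE : IsHardSphereEulerSolution σ (t + 1) (fun _ _ => (1 : ℝ)) (fun _ _ => (0 : V3)) (fun _ _ => (1 : ℝ)) :=
    constState_isSolution σ (t + 1) one_pos one_pos
  have htT : t ∈ Ico 0 (t + 1) := ⟨ht, by linarith⟩
  refine capLimit_of_densityLLNUpTo hE Φ (H σ hσ hσ1 Φ 0) htT ?_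
  intro s _ χ hχ δ hδ
  exact (H σ hσ hσ1 Φ s χ hχ δ hδ).1

/-! ## §I (gen-3) Minimal signatures: the stub hypotheses that are now TREE THEOREMS or decorative can be dropped -/

/-- For `t < 0` the overshoot event is empty, so `CapLimit … t` is trivial (E's `ht` is decorative). -/
theorem capLimit_of_neg (σ : ℝ) (a₀ θ₀ : T3 → ℝ) (u₀ : T3 → V3) (Φ : Flows σ) (ρ : ℝ → T3 → ℝ) {t : ℝ}
    (ht : t < 0) : CapLimit σ a₀ u₀ θ₀ Φ ρ t := by
  intro η δ _ _
  refine ⟨1, one_pos, fun r _ _ => ⟨0, fun N _ => ?_⟩⟩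
  have hempty : capEvent Φ N ρ t η r = ∅ := by
    refine Set.eq_empty_of_forall_notMem fun z hz => ?_
    obtain ⟨s, hs, -⟩ := hz
    exact absurd (hs.1.trans hs.2) (not_le.2 ht)
  rw [hempty, measure_empty]
  exact zero_le

/-- **STUB E, minimal form**: `hdisp` DROPPED (it is the landed theorem `stub_meanDisplacement`, p76245, for every
hard-sphere flow) and `ht` DROPPED (`t < 0` is trivial) — energy tightness + density modulus + fixed-time density
LLN on `[0, t]` ⇒ the cap. This is the reusable `GridUpgrade` lemma shape (Disproof §11's recommended restatement). -/
theorem gridUpgrade_min {σ : ℝ} (a₀ θ₀ : T3 → ℝ) (u₀ : T3 → V3) (Φ : Flows σ) (ρ : ℝ → T3 → ℝ) {t K : ℝ}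
    (hK : Tendsto (fun N => localGibbsLaw σ a₀ u₀ θ₀ N (Φ N)
      {z | K < ((N + 1 : ℕ) : ℝ)⁻¹ * configEnergy z}) atTop (𝓝 0))
    (hmod : ∀ η : ℝ, 0 < η → ∃ r₀ : ℝ, 0 < r₀ ∧ r₀ ≤ 1 / 2 ∧
      (∀ r : ℝ, 0 < r → r < r₀ → ∀ s ∈ Icc 0 t, ∀ x : T3, ∫ y, cone r y x * ρ s y ≤ ρ s x + η) ∧
      ∃ τ₀ : ℝ, 0 < τ₀ ∧ ∀ s ∈ Icc 0 t, ∀ s' ∈ Icc 0 t, |s - s'| ≤ τ₀ →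
        ∀ x x' : T3, Torus.euclidDist x x' ≤ r₀ → |ρ s x - ρ s' x'| ≤ η)
    (hlln : ∀ s ∈ Icc 0 t, ∀ χ : T3 → ℝ, Continuous χ → ∀ δ : ℝ, 0 < δ →
      Tendsto (fun N => localGibbsLaw σ a₀ u₀ θ₀ N (Φ N)
        {z | δ < |empiricalDensityField ((Φ N).flow s z) χ - ∫ x, χ x * ρ s x|}) atTop (𝓝 0)) :
    CapLimit σ a₀ u₀ θ₀ Φ ρ t := by
  rcases lt_or_ge t 0 with ht | ht
  · exact capLimit_of_neg σ a₀ θ₀ u₀ Φ ρ ht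
  · exact stub_gridUpgrade a₀ θ₀ u₀ Φ ρ ht (fun N _ hz s s' => stub_meanDisplacement (Φ N) hz s s') hK hmod hlln

/-- **STUB D, minimal form**: `hclock` and `hlip` DROPPED — both are theorems for every hard-sphere flow and every
`r > 0` (`clock_of_meanDisplacement` ∘ landed `stub_meanDisplacement`; `mollDensity_lipschitz_centre`). -/
theorem capEventSubset_min {ε : ℝ} {n : ℕ} (Ψ : HardSphereFlow (Torus.geometry (Fin 3)) ε n)
    (ρ : ℝ → T3 → ℝ) {t η r r₀ τ₀ K δx δt : ℝ} (hr : 0 < r)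
    (hmod1 : ∀ s ∈ Icc 0 t, ∀ x : T3, ∫ y, cone r y x * ρ s y ≤ ρ s x + η / 4)
    (hmod2 : ∀ s ∈ Icc 0 t, ∀ s' ∈ Icc 0 t, |s - s'| ≤ τ₀ →
      ∀ x x' : T3, Torus.euclidDist x x' ≤ r₀ → |ρ s x - ρ s' x'| ≤ η / 4)
    (Sx : Finset T3) (hSx : ∀ x : T3, ∃ x' ∈ Sx, Torus.euclidDist x x' ≤ δx)
    (hδx₁ : δx ≤ r₀) (hδx₂ : 3 / (Real.pi * r ^ 4) * δx ≤ η / 8)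
    (St : Finset ℝ) (hSt : ∀ s ∈ St, s ∈ Icc 0 t) (hSt' : ∀ s ∈ Icc 0 t, ∃ s' ∈ St, |s - s'| ≤ δt)
    (hδt₁ : δt ≤ τ₀) (hδt₂ : 3 / (Real.pi * r ^ 4) * Real.sqrt (2 * K) * δt ≤ η / 8) :
    {z | ∃ s ∈ Icc 0 t, ∃ x : T3, ρ s x + η < mollDensity r (Ψ.flow s z) x} ∩ Ψ.good ∩
        {z | (n : ℝ)⁻¹ * configEnergy z ≤ K} ⊆
      ⋃ s ∈ St, ⋃ x ∈ Sx, {z | η / 4 < |empiricalDensityField (Ψ.flow s z) (fun y => cone r y x) -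
        ∫ y, cone r y x * ρ s y|} := by
  refine stub_capEventSubset Ψ ρ hr (fun z hz s s' x₀ => ?_) (mollDensity_lipschitz_centre hr) hmod1 hmod2
    Sx hSx hδx₁ hδx₂ St hSt hSt' hδt₁ hδt₂
  simpa only [mul_assoc] using
    clock_of_meanDisplacement hr (Ψ.flow s z) (Ψ.flow s' z) x₀ (stub_meanDisplacement Ψ hz s s')

/-- STUB E with the fixed-time density LLN `hlln` DROPPED (all other hypotheses kept, `K` free). -/
def GridUpgradeWithoutLLN : Prop :=
  ∀ (σ : ℝ) (a₀ θ₀ : T3 → ℝ) (u₀ : T3 → V3) (Φ : Flows σ) (ρ : ℝ → T3 → ℝ) (t : ℝ), 0 ≤ t →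
    (∀ N : ℕ, ∀ z ∈ (Φ N).good, ∀ s s' : ℝ,
      ((N + 1 : ℕ) : ℝ)⁻¹ * ∑ i, Torus.euclidDist (((Φ N).flow s' z i).1) (((Φ N).flow s z i).1) ≤
        Real.sqrt (2 * (((N + 1 : ℕ) : ℝ)⁻¹ * configEnergy z)) * |s' - s|) →
    ∀ K : ℝ, Tendsto (fun N => localGibbsLaw σ a₀ u₀ θ₀ N (Φ N)
      {z | K < ((N + 1 : ℕ) : ℝ)⁻¹ * configEnergy z}) atTop (𝓝 0) →
    (∀ η : ℝ, 0 < η → ∃ r₀ : ℝ, 0 < r₀ ∧ r₀ ≤ 1 / 2 ∧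
      (∀ r : ℝ, 0 < r → r < r₀ → ∀ s ∈ Icc 0 t, ∀ x : T3, ∫ y, cone r y x * ρ s y ≤ ρ s x + η) ∧
      ∃ τ₀ : ℝ, 0 < τ₀ ∧ ∀ s ∈ Icc 0 t, ∀ s' ∈ Icc 0 t, |s - s'| ≤ τ₀ →
        ∀ x x' : T3, Torus.euclidDist x x' ≤ r₀ → |ρ s x - ρ s' x'| ≤ η) →
    CapLimit σ a₀ u₀ θ₀ Φ ρ t

/-- **STUB E without `hlln` is FALSE** (so the fixed-time density LLN is load-bearing): witness = the homogeneous
equilibrium data `(1, 1, 0)` at `σ = σ₁/2` (laws are probability measures and TIED at `t = 0`, `homogeneous_lln`;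
flows exist, `flows_nonempty`; energies tight by `energyTight_of_tie`; displacement bound = landed STUB A), the
constant NEGATIVE field `ρ ≡ −2` (which satisfies the modulus package trivially) and `t = 0`, `η = 1`, `δ = 1/2`:
the overshoot event is everything (`ρ̄ʳ ≥ 0 > −2 + 1`), of probability `1 > 1/2` at every `N`. -/
theorem not_gridUpgrade_without_hlln : ¬ GridUpgradeWithoutLLN := by
  intro h
  obtain ⟨σ₁, hσ₁, hσ₁2, H⟩ := Theorems.DensityCapNegative.homogeneous_lln
  have hσ : (0 : ℝ) < σ₁ / 2 := by positivity
  have hσlt : σ₁ / 2 < σ₁ := by linarith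
  have hσ2 : σ₁ / 2 < 1 / 2 := by linarith
  obtain ⟨Φ⟩ := Theorems.PolynomialCompressionPDE.flows_nonempty hσ hσ2
  obtain ⟨hP, h0⟩ := H (σ₁ / 2) hσ hσlt Φ
  have hdisp : ∀ N : ℕ, ∀ z ∈ (Φ N).good, ∀ s s' : ℝ,
      ((N + 1 : ℕ) : ℝ)⁻¹ * ∑ i, Torus.euclidDist (((Φ N).flow s' z i).1) (((Φ N).flow s z i).1) ≤
        Real.sqrt (2 * (((N + 1 : ℕ) : ℝ)⁻¹ * configEnergy z)) * |s' - s| :=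
    fun N z hz s s' => stub_meanDisplacement (Φ N) hz s s'
  have hK := energyTight_of_tie Φ h0
  have hmod : ∀ η : ℝ, 0 < η → ∃ r₀ : ℝ, 0 < r₀ ∧ r₀ ≤ 1 / 2 ∧
      (∀ r : ℝ, 0 < r → r < r₀ → ∀ s ∈ Icc (0 : ℝ) 0, ∀ x : T3,
        ∫ y, cone r y x * (fun (_ : ℝ) (_ : T3) => (-2 : ℝ)) s y ≤ (fun (_ : ℝ) (_ : T3) => (-2 : ℝ)) s x + η) ∧
      ∃ τ₀ : ℝ, 0 < τ₀ ∧ ∀ s ∈ Icc (0 : ℝ) 0, ∀ s' ∈ Icc (0 : ℝ) 0, |s - s'| ≤ τ₀ →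
        ∀ x x' : T3, Torus.euclidDist x x' ≤ r₀ →
          |(fun (_ : ℝ) (_ : T3) => (-2 : ℝ)) s x - (fun (_ : ℝ) (_ : T3) => (-2 : ℝ)) s' x'| ≤ η := by
    intro η hη
    refine ⟨1 / 2, by norm_num, le_rfl, fun r hr hr2 s _ x => ?_, 1, one_pos, fun s _ s' _ _ x x' _ => ?_⟩
    · have hint : ∫ y, cone r y x * (-2 : ℝ) = -2 := by
        rw [integral_mul_const, integral_cone_left hr hr2.le x, one_mul]
      show ∫ y, cone r y x * (-2 : ℝ) ≤ -2 + η
      rw [hint]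
      linarith
    · show |(-2 : ℝ) - -2| ≤ η
      norm_num
      exact hη.le
  have hcap := h (σ₁ / 2) (fun _ => 1) (fun _ => 1) (fun _ => 0) Φ (fun _ _ => -2) 0 le_rfl hdisp _ hK hmod
  obtain ⟨r₀, hr₀, hr⟩ := hcap 1 (1 / 2) one_pos (by norm_num)
  have hrpos : 0 < min (r₀ / 2) (1 / 4) := lt_min (by positivity) (by norm_num)
  have hrlt : min (r₀ / 2) (1 / 4) < r₀ := lt_of_le_of_lt (min_le_left _ _) (by linarith)
  obtain ⟨N₀, hN⟩ := hr (min (r₀ / 2) (1 / 4)) hrpos hrlt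
  have hle := hN N₀ le_rfl
  have huniv : capEvent Φ N₀ (fun _ _ => (-2 : ℝ)) 0 1 (min (r₀ / 2) (1 / 4)) = Set.univ := by
    refine Set.eq_univ_of_forall fun z => ⟨0, ⟨le_rfl, le_rfl⟩, 0, ?_⟩
    have h0le := Theorems.DensityCapNegative.mollDensity_nonneg hrpos ((Φ N₀).flow 0 z) 0
    show (-2 : ℝ) + 1 < mollDensity (min (r₀ / 2) (1 / 4)) ((Φ N₀).flow 0 z) 0
    linarith
  rw [huniv] at hle
  haveI := hP N₀
  rw [measure_univ] at hle
  have hlt : ENNReal.ofReal (1 / 2 : ℝ) < 1 := by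
    rw [← ENNReal.ofReal_one]
    exact (ENNReal.ofReal_lt_ofReal_iff one_pos).2 (by norm_num)
  exact absurd hle (not_le.2 hlt)

/-- Type pins of the end state (no `sorry` anywhere in this file). -/
example : Theses.ImplosionDichotomy.HydroLimitInBand → Theses.JParityClosure.DiluteSelfConsistency →
    Theses.JParityClosure.DensityCap := DensityCap_of
example : _root_.HydrodynamicLimit → Theses.JParityClosure.DensityCap := densityCap_of_hydrodynamicLimit

end DrefuteG3.LandedCompose

/-- gen-3 FQN pin (no `open` in force here): the composition concludes THE route decl by its fully-qualified name. -/
example : Summit.AtomisticToContinuum.HydrodynamicLimit.Theses.ImplosionDichotomy.HydroLimitInBand →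
    Summit.AtomisticToContinuum.HydrodynamicLimit.Theses.JParityClosure.DiluteSelfConsistency →
    Summit.AtomisticToContinuum.HydrodynamicLimit.Theses.JParityClosure.DensityCap :=
  DrefuteG3.LandedCompose.DensityCap_of

example : HydrodynamicLimit → Summit.AtomisticToContinuum.HydrodynamicLimit.Theses.JParityClosure.DensityCap :=
  DrefuteG3.LandedCompose.densityCap_of_hydrodynamicLimit

/-- gen-3 pin: the four stub proofs have EXACTLY the registered signatures (statement-level `Iff.rfl`-free check:
the skeleton's stub types, restated verbatim with fully-qualified names, are inhabited by the g1/g2 proofs). -/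
example : ∀ {ε : ℝ} {n : ℕ} (Ψ : Literature.Analysis.FluidPDE.HardSphereFlow
      (Literature.Analysis.FluidPDE.Torus.geometry (Fin 3)) ε n)
    {z : Literature.Analysis.FluidPDE.Config n (Fin 3) Literature.MathematicalPhysics.KineticTheory.T3}
    (_hz : z ∈ Ψ.good) (s s' : ℝ),
    (n : ℝ)⁻¹ * ∑ i, Literature.Analysis.FluidPDE.Torus.euclidDist ((Ψ.flow s' z i).1) ((Ψ.flow s z i).1) ≤
      Real.sqrt (2 * ((n : ℝ)⁻¹ * Literature.Analysis.FluidPDE.configEnergy z)) * |s' - s| :=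
  fun Ψ _ hz s s' => DrefuteG3.LandedCompose.stub_meanDisplacement Ψ hz s s'

end
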